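import Literature.NumberTheory.LFunctions.ConreyIwaniec2002CircleMethodDefs
import Mathlib.Analysis.SpecialFunctions.Integrals.Basic
import HarnessLib

/-!
# Conrey–Iwaniec (2002), §4 (4.10): the zero detector of Kloosterman's circle method (Farey dissection), by induction on the order

B. Conrey, H. Iwaniec, *Spacing of zeros of Hecke `L`-functions and the class number problem*,
Acta Arith. 103 (2002), §4 (4.10) [held text `paper:arxiv-math_0111012`, p0010:L57–63]: "the
following formula for the zero detector in `ℤ`:
`2Σ_{c ≤ C < d ≤ c+C, (c,d)=1} ∫₀^{1/cd} cos(2πn(a/c − α))dα = 1` if `n = 0`, `0` if `n ≠ 0` (4.10),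
where `ad ≡ 1 (mod c)` and `C ≥ 2` is at our disposal (see Proposition 11.1 of [I])." Registered
stub S3b1 `stub_zero_detector` of SKELETON S3 (cell `landau-siegel/ls-inputs`, line
`theta-circle-method`), PROVED: `zeroDetectorIdentity_holds : ZeroDetectorIdentity` (interface of
`ConreyIwaniec2002CircleMethodDefs.lean`, statement verbatim).

Proof (the mediant-insertion step of the Farey dissection as an integral identity, no Farey
sequences needed): by induction on `C`. For `C = 1` the only pair is `(1, 2)` and
`2∫₀^{1/2}cos(2πnβ)dβ = [n = 0]`. Passing from `C` to `C + 1`, the pairs `(c, C+1)` (`c ≤ C`,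
`(c, C+1) = 1`) leave and, for the same `c`, the pairs `(c, c+C+1)` and `(C+1, c+C+1)` enter; with
`a = (C+1)⁻¹ = (c+C+1)⁻¹ (mod c)` and `a″ = c⁻¹ = (c+C+1)⁻¹ (mod C+1)` one has
`∫₀^{1/(c(C+1))}cos(2πn(a/c − β))dβ = ∫₀^{1/(c(c+C+1))}cos(2πn(a/c − β))dβ +
∫₀^{1/((C+1)(c+C+1))}cos(2πn(a″/(C+1) − β))dβ`: the middle piece `[1/(c(c+C+1)), 1/(c(C+1))]` has
length `1/((C+1)(c+C+1))`, and after `β ↦ 1/(c(C+1)) − γ` its integrand is `cos(2πn(a″/(C+1) − γ))`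
because `a/c − 1/(c(C+1)) + a″/(C+1) = (a(C+1) + a″c − 1)/(c(C+1)) ∈ ℤ` (`c` and `C+1` both divide
the numerator and are coprime) and `cos` is even and `2π`-periodic. Hence the double sum does not
depend on `C`.

## References

* [ConreyIwaniec2002] B. Conrey, H. Iwaniec, Acta Arith. 103 (2002) 259–312, arXiv:math/0111012:
  §4 (4.10).
* H. Iwaniec, *Topics in Classical Automorphic Forms*, AMS (1997), Proposition 11.1 (the source's [I]).
-/

noncomputable section

open Finset MeasureTheory intervalIntegral

namespace Literature.NumberTheory.LFunctions

namespace ConreyIwaniec2002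

/-! ### The arc integrand and the mediant-insertion identity -/

/-- The arc integral is that of a continuous function. [folklore] -/
private theorem arc_integrable (n : ℤ) (x : ℝ) (a b : ℝ) :
    IntervalIntegrable (fun α : ℝ ↦ Real.cos (2 * Real.pi * n * (x - α))) volume a b :=
  (Real.continuous_cos.comp (continuous_const.mul (continuous_const.sub continuous_id))).intervalIntegrable
    _ _

/-- `a = e⁻¹ (mod c)` and `a″ = c⁻¹ (mod e)` with `(c, e) = 1`: `(a·e + a″·c − 1)/(c·e)` is an
integer. [folklore] -/
private theorem exists_int_crossterm {c e : ℕ} (hc : 1 ≤ c) (he : 1 ≤ e) (hce : Nat.Coprime c e) :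
    ∃ k : ℤ, ((((e : ZMod c)⁻¹).val : ℤ) * e + (((c : ZMod e)⁻¹).val : ℤ) * c - 1 : ℤ) =
      (c : ℤ) * e * k := by
  haveI : NeZero c := ⟨by omega⟩
  haveI : NeZero e := ⟨by omega⟩
  set N : ℤ := (((e : ZMod c)⁻¹).val : ℤ) * e + (((c : ZMod e)⁻¹).val : ℤ) * c - 1 with hN
  have hue : IsUnit (e : ZMod c) := (ZMod.isUnit_iff_coprime e c).mpr hce.symm
  have huc : IsUnit (c : ZMod e) := (ZMod.isUnit_iff_coprime c e).mpr hce
  have hc_dvd : (c : ℤ) ∣ N := by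
    rw [← ZMod.intCast_zmod_eq_zero_iff_dvd, hN]
    push_cast
    rw [ZMod.natCast_zmod_val, ZMod.natCast_self, mul_zero, add_zero, ZMod.inv_mul_of_unit _ hue,
      sub_self]
  have he_dvd : (e : ℤ) ∣ N := by
    rw [← ZMod.intCast_zmod_eq_zero_iff_dvd, hN]
    push_cast
    rw [ZMod.natCast_zmod_val, ZMod.natCast_self, mul_zero, zero_add, ZMod.inv_mul_of_unit _ huc,
      sub_self]
  have hcop : IsCoprime (c : ℤ) (e : ℤ) := Nat.isCoprime_iff_coprime.mpr hce
  obtain ⟨k, hk⟩ := hcop.mul_dvd hc_dvd he_dvd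
  exact ⟨k, hk⟩

/-- **The mediant-insertion identity**: for `1 ≤ c`, `1 ≤ e`, `(c, e) = 1`, `d = c + e`, with
`a = e⁻¹ = d⁻¹ (mod c)`, `a″ = c⁻¹ = d⁻¹ (mod e)`:
`∫₀^{1/(ce)}cos(2πn(a/c − β))dβ = ∫₀^{1/(cd)}cos(2πn(a/c − β))dβ + ∫₀^{1/(ed)}cos(2πn(a″/e − β))dβ`.
[folklore] -/
private theorem arc_split {c e d : ℕ} (hc : 1 ≤ c) (he : 1 ≤ e) (hce : Nat.Coprime c e)
    (hd : d = c + e) (n : ℤ) :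
    (∫ α in (0 : ℝ)..(1 / ((c : ℝ) * e)),
        Real.cos (2 * Real.pi * n * ((((e : ZMod c)⁻¹).val : ℝ) / c - α))) =
      (∫ α in (0 : ℝ)..(1 / ((c : ℝ) * d)),
          Real.cos (2 * Real.pi * n * ((((d : ZMod c)⁻¹).val : ℝ) / c - α))) +
        ∫ α in (0 : ℝ)..(1 / ((e : ℝ) * d)),
          Real.cos (2 * Real.pi * n * ((((d : ZMod e)⁻¹).val : ℝ) / e - α)) := by
  haveI : NeZero c := ⟨by omega⟩
  haveI : NeZero e := ⟨by omega⟩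
  have hdc : (d : ZMod c) = (e : ZMod c) := by
    rw [hd]; push_cast; rw [ZMod.natCast_self, zero_add]
  have hde : (d : ZMod e) = (c : ZMod e) := by
    rw [hd]; push_cast; rw [ZMod.natCast_self, add_zero]
  rw [hdc, hde]
  have hc0 : (0 : ℝ) < c := by exact_mod_cast hc
  have he0 : (0 : ℝ) < e := by exact_mod_cast he
  have hdR : (d : ℝ) = c + e := by rw [hd]; push_cast; ring
  have hd0 : (0 : ℝ) < d := by rw [hdR]; linarith
  set a : ℝ := (((e : ZMod c)⁻¹).val : ℝ) with ha
  set a'' : ℝ := (((c : ZMod e)⁻¹).val : ℝ) with ha''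
  obtain ⟨k, hk⟩ := exists_int_crossterm hc he hce
  have hk' : a * e + a'' * c - 1 = (c : ℝ) * e * k := by
    rw [ha, ha'']
    exact_mod_cast hk
  set f : ℝ → ℝ := fun α ↦ Real.cos (2 * Real.pi * n * (a / c - α)) with hf
  -- Step A: split the arc `[0, 1/(ce)]` at `1/(cd)`
  have hA : (∫ α in (0 : ℝ)..(1 / ((c : ℝ) * e)), f α) =
      (∫ α in (0 : ℝ)..(1 / ((c : ℝ) * d)), f α) +
        ∫ α in (1 / ((c : ℝ) * d))..(1 / ((c : ℝ) * e)), f α :=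
    (integral_add_adjacent_intervals (arc_integrable n (a / c) _ _)
      (arc_integrable n (a / c) _ _)).symm
  -- Step B: reflect the middle piece `β ↦ 1/(ce) − γ`
  have hlen : 1 / ((c : ℝ) * e) - 1 / ((e : ℝ) * d) = 1 / ((c : ℝ) * d) := by
    rw [hdR]; field_simp; ring
  have hB : (∫ γ in (0 : ℝ)..(1 / ((e : ℝ) * d)), f (1 / ((c : ℝ) * e) - γ)) =
      ∫ α in (1 / ((c : ℝ) * d))..(1 / ((c : ℝ) * e)), f α := by
    rw [intervalIntegral.integral_comp_sub_left (fun α ↦ f α) (1 / ((c : ℝ) * e)), hlen, sub_zero]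
  -- Step C: the reflected integrand is the arc integrand of `(e, d)`
  have hC : ∀ γ : ℝ, f (1 / ((c : ℝ) * e) - γ) = Real.cos (2 * Real.pi * n * (a'' / e - γ)) := by
    intro γ
    have hshift : a / c - (1 / ((c : ℝ) * e) - γ) = -(a'' / e - γ) + (n * k : ℤ) * 0 + k := by
      have : a / c - 1 / ((c : ℝ) * e) = k - a'' / e := by
        field_simp
        linear_combination hk'
      push_cast
      linarith [this]
    simp only [hf]
    rw [hshift]
    push_cast
    rw [mul_zero, add_zero, mul_add, show 2 * Real.pi * (n : ℝ) * (k : ℝ) = ((n * k : ℤ) : ℝ) * (2 * Real.pi) by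
      push_cast; ring, Real.cos_add_int_mul_two_pi, mul_neg, Real.cos_neg]
  rw [hA, ← hB]
  congr 1
  refine intervalIntegral.integral_congr fun γ _ ↦ ?_
  exact hC γ

/-! ### The double sum and its invariance under `C ↦ C + 1` -/

/-- Shifting the `d`-range: `Σ_{C+1<d≤c+C+1} g = Σ_{C<d≤c+C} g − g(C+1) + g(c+C+1)` for `c ≥ 1`.
[folklore] -/
private theorem sum_Ioc_shift (g : ℕ → ℝ) {C c : ℕ} (hc : 1 ≤ c) :
    ∑ d ∈ Ioc (C + 1) (c + C + 1), g d = (∑ d ∈ Ioc C (c + C), g d) - g (C + 1) + g (c + C + 1) := by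
  have h1 : ∑ d ∈ Ioc (C + 1) (c + C + 1), g d = (∑ d ∈ Ioc (C + 1) (c + C), g d) + g (c + C + 1) :=
    Finset.sum_Ioc_succ_top (by omega) g
  have h2 : (∑ d ∈ Ioc C (C + 1), g d) + ∑ d ∈ Ioc (C + 1) (c + C), g d = ∑ d ∈ Ioc C (c + C), g d :=
    Finset.sum_Ioc_consecutive g (by omega) (by omega)
  have h3 : ∑ d ∈ Ioc C (C + 1), g d = g (C + 1) := by
    rw [show Ioc C (C + 1) = {C + 1} by
        ext x; simp only [Finset.mem_Ioc, Finset.mem_singleton]; omega, Finset.sum_singleton]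
  linarith [h1, h2, h3]

/-- Re-indexing the new row: `Σ_{C+1<d≤2C+2} g d = Σ_{1≤c≤C+1} g(c+C+1)`. [folklore] -/
private theorem sum_Ioc_top_row (g : ℕ → ℝ) (C : ℕ) :
    ∑ d ∈ Ioc (C + 1) (C + 1 + (C + 1)), g d = ∑ c ∈ Icc 1 (C + 1), g (c + C + 1) := by
  rw [show Ioc (C + 1) (C + 1 + (C + 1)) = (Ioc 0 (C + 1)).map (addRightEmbedding (C + 1)) by
      rw [Finset.map_add_right_Ioc, zero_add], Finset.sum_map]
  rw [show Ioc 0 (C + 1) = Icc 1 (C + 1) by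
      ext x; simp only [Finset.mem_Ioc, Finset.mem_Icc]; omega]
  refine Finset.sum_congr rfl fun c _ ↦ ?_
  simp only [addRightEmbedding_apply]
  congr 1

/-- **(4.10)** (registered stub `stub_zero_detector` of SKELETON S3, interface
`ZeroDetectorIdentity`): `2Σ_{c≤C<d≤c+C,(c,d)=1}∫₀^{1/cd}cos(2πn(a/c − α))dα = [n = 0]`,
`ad ≡ 1 (mod c)`. [cite: ConreyIwaniec2002, §4 (4.10)] -/
theorem zeroDetectorIdentity_holds : ZeroDetectorIdentity := by
  intro C hC n
  -- the summand, with the coprimality indicator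
  set g : ℕ → ℕ → ℝ := fun c d ↦ if Nat.Coprime c d then
      ∫ α in (0 : ℝ)..(1 / ((c : ℝ) * d)),
        Real.cos (2 * Real.pi * n * ((((d : ZMod c)⁻¹).val : ℝ) / c - α)) else 0 with hg
  set F : ℕ → ℝ := fun C ↦ ∑ c ∈ Icc 1 C, ∑ d ∈ Ioc C (c + C), g c d with hF
  have hFdef : ∀ C : ℕ, (∑ c ∈ Icc 1 C, ∑ d ∈ (Ioc C (c + C)).filter (fun d ↦ Nat.Coprime c d),
      ∫ α in (0 : ℝ)..(1 / ((c : ℝ) * d)),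
        Real.cos (2 * Real.pi * n * ((((d : ZMod c)⁻¹).val : ℝ) / c - α))) = F C := by
    intro C
    simp only [hF, hg, Finset.sum_filter]
  rw [hFdef]
  -- invariance `F (C + 1) = F C` for `C ≥ 1`
  have hstep : ∀ C : ℕ, 1 ≤ C → F (C + 1) = F C := by
    intro C hC1
    simp only [hF]
    rw [Finset.sum_Icc_succ_top (by omega)]
    -- the rows `c ≤ C`
    have hrows : ∑ c ∈ Icc 1 C, ∑ d ∈ Ioc (C + 1) (c + (C + 1)), g c d =
        ∑ c ∈ Icc 1 C, ((∑ d ∈ Ioc C (c + C), g c d) - g c (C + 1) + g c (c + C + 1)) := by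
      refine Finset.sum_congr rfl fun c hc ↦ ?_
      rw [Finset.mem_Icc] at hc
      rw [show c + (C + 1) = c + C + 1 by omega]
      exact sum_Ioc_shift (g c) hc.1
    -- the new row `c = C + 1`
    have hrow : ∑ d ∈ Ioc (C + 1) (C + 1 + (C + 1)), g (C + 1) d =
        ∑ c ∈ Icc 1 C, g (C + 1) (c + C + 1) := by
      rw [sum_Ioc_top_row (g (C + 1)) C, Finset.sum_Icc_succ_top (by omega)]
      have hlast : g (C + 1) (C + 1 + C + 1) = 0 := by
        simp only [hg]
        rw [if_neg]
        rw [show C + 1 + C + 1 = (C + 1) * 2 by ring, Nat.Coprime, Nat.gcd_mul_right_right]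
        omega
      rw [hlast, add_zero]
    -- per `c`: the three indicator terms cancel by `arc_split`
    have hper : ∀ c ∈ Icc 1 C, -g c (C + 1) + g c (c + C + 1) + g (C + 1) (c + C + 1) = 0 := by
      intro c hc
      rw [Finset.mem_Icc] at hc
      have h1 : Nat.Coprime c (c + C + 1) ↔ Nat.Coprime c (C + 1) := by
        rw [show c + C + 1 = c + (C + 1) by omega, Nat.Coprime, Nat.Coprime, Nat.gcd_self_add_right]
      have h2 : Nat.Coprime (C + 1) (c + C + 1) ↔ Nat.Coprime c (C + 1) := by
        rw [show c + C + 1 = c + (C + 1) by omega, Nat.Coprime, Nat.Coprime, Nat.gcd_add_self_right,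
          Nat.gcd_comm]
      simp only [hg]
      by_cases hco : Nat.Coprime c (C + 1)
      · rw [if_pos hco, if_pos (h1.mpr hco), if_pos (h2.mpr hco)]
        have := arc_split hc.1 (by omega : 1 ≤ C + 1) hco (show c + C + 1 = c + (C + 1) by omega) n
        push_cast at this ⊢
        linarith
      · rw [if_neg hco, if_neg (fun h ↦ hco (h1.mp h)), if_neg (fun h ↦ hco (h2.mp h))]
        ring
    rw [hrows, hrow, ← Finset.sum_add_distrib]
    refine Finset.sum_congr rfl fun c hc ↦ ?_
    have := hper c hc
    linarith
  -- hence `F C = F 1`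
  have hconst : ∀ C : ℕ, 1 ≤ C → F C = F 1 := by
    intro C hC1
    induction C, hC1 using Nat.le_induction with
    | base => rfl
    | succ C hC1 ih => rw [hstep C hC1, ih]
  rw [hconst C hC]
  -- the base case `C = 1`: the single pair `(1, 2)`
  simp only [hF]
  rw [Finset.Icc_self, Finset.sum_singleton,
    show Ioc 1 (1 + 1) = {2} by
      ext x; simp only [Finset.mem_Ioc, Finset.mem_singleton]; omega, Finset.sum_singleton]
  simp only [hg]
  rw [if_pos (by norm_num : Nat.Coprime 1 2)]
  have hval2 : ∀ x : ZMod 1, (x.val : ℝ) = 0 := fun x ↦ by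
    rw [Subsingleton.elim x 0, ZMod.val_zero, Nat.cast_zero]
  simp only [hval2, zero_div, zero_sub, Nat.cast_one, one_mul, Nat.cast_ofNat]
  by_cases hn : n = 0
  · subst hn
    simp
  · rw [if_neg hn]
    have hn' : (2 * Real.pi * (n : ℝ)) ≠ 0 := by
      have : (n : ℝ) ≠ 0 := by exact_mod_cast hn
      positivity
    have key : ∫ α in (0 : ℝ)..(1 / 2), Real.cos (2 * Real.pi * n * -α) = 0 := by
      have h1 : (fun α : ℝ ↦ Real.cos (2 * Real.pi * n * -α)) =
          fun α ↦ Real.cos ((2 * Real.pi * n) * α) := by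
        funext α; rw [mul_neg, Real.cos_neg]
      rw [h1, intervalIntegral.integral_comp_mul_left (fun x ↦ Real.cos x) hn', integral_cos]
      rw [mul_zero, Real.sin_zero, sub_zero,
        show 2 * Real.pi * (n : ℝ) * (1 / 2) = (n : ℝ) * Real.pi by ring]
      rw [show (n : ℝ) * Real.pi = ((n : ℤ) : ℝ) * Real.pi by norm_cast, Real.sin_int_mul_pi]
      simp
    rw [key, mul_zero]

/-- **S3b1** (registered stub `stub_zero_detector` of SKELETON S3, statement verbatim).
[cite: ConreyIwaniec2002, §4 (4.10)] -/
theorem zero_detector : ZeroDetectorIdentity := zeroDetectorIdentity_holds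

end ConreyIwaniec2002

end Literature.NumberTheory.LFunctions

end
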